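import Mathlib
import Summits.KontsevichZagierPeriods.KontsevichZagierPeriods.Theorems.SoloInformedLengthFaces
import Summits.KontsevichZagierPeriods.KontsevichZagierPeriods.Theorems.SoloInformedLengthFacesCatalan
import HarnessLib
import HarnessLib.Audit

/-!
# SoloInformed — padded monomial faces: `ζ(5)/ζ(3)`, `ζ(3)/G`, `ζ(3)/log 2`, `ζ(3)/π`, `G/π`, `G/log 2`

The paper of the residency (§3quater.5bis) proves MONOMIAL RIGIDITY (Proposition L′): in the ring of
realised periods of the relevant Betti–de Rham structures, two distinct monomials in
`⟦π⟧, log̃ 2, G̃, η̃(3), η̃(5), …` are never `ℚ`-proportional, and deduces (Corollary II⁗) that for ANY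
two distinct monomials `m ≠ m′` in `π, log 2, G, ζ(3), ζ(5), …` the localised no-certificate
statement `NoLocRel(S_m, S_{m′})` holds for sub-graph KZ-solids `S_m, S_{m′}` of volumes `∈ ℚˣ m`,
`ℚˣ m′` placed in a COMMON cube; consequently `LocRung_D ⇒ m/m′ ∉ ℚ`.

To place two solids in a common cube one PADS the smaller one: the sub-graph solid of a polynomial
`q ∈ ℚ[x₀,…,x_{n−1}]` regarded in `n + k` variables is the block product `E_q ⊠ E_1 = E_{q ⊠ 1}`
with the constant polynomial `1` in `k` variables, whose solid `E_1 = [0,1]^{k+1}` has volume `1`.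
This file supplies the padding block and records six faces of Corollary II⁗ that need it — among
them the most striking consequences of low rungs of the Kontsevich–Zagier conjecture found by the
residency:

* **P1** (`LocRung₆`): `E_η(5)` against `E_η(3)` padded to `[0,1]⁶` — **`NoLocRel ↔ ζ(5)/ζ(3) ∉ ℚ`**;
* **P2** (`LocRung₄`): `E_η(3)` against `E_G` padded to `[0,1]⁴` — **`NoLocRel ↔ ζ(3)/G ∉ ℚ`**;
* **P3** (`LocRung₄`): `E_η(3)` against `Λ₁` padded — **`NoLocRel ↔ ζ(3)/log 2 ∉ ℚ`**;
* **P4** (`LocRung₄`): `E_η(3)` against `A₁` padded — **`NoLocRel ↔ ζ(3)/π ∉ ℚ`**;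
* **P5** (`LocRung₃`): `E_G` against `A₁` padded to `[0,1]³` — **`NoLocRel ↔ G/π ∉ ℚ`**;
* **P6** (`LocRung₃`): `E_G` against `Λ₁` padded — **`NoLocRel ↔ G/log 2 ∉ ℚ`**.

All six irrationality statements are OPEN [Waldschmidt 2004, §3; Finch 2003, §§1.6–1.7] and follow
from Grothendieck's period conjecture for mixed Tate motives over `ℤ[i, 1/2]`.  The kernel content is
the padding block, the exact equivalence at each rung and the volumes; the `NoLocRel` statements are
proved in the paper (inputs in print: Dupont–Fresán, arXiv:2305.00789, Def. 1.2, Thms. 3.3, 3.9;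
Q. Wang, arXiv:math/0610670, Thm. 13).  Residency `solo-KontsevichZagierPeriods-informed` (s20).
References: M. Kontsevich, D. Zagier, *Periods* (2001), §1.2; M. Waldschmidt, *Open Diophantine
problems*, Moscow Math. J. 4 (2004), §3; S. R. Finch, *Mathematical constants* (2003), §§1.6, 1.7.
-/

noncomputable section

open MeasureTheory Set Filter
namespace Summit.KontsevichZagierPeriods.KontsevichZagierPeriods.Theorems

open Literature.NumberTheory.Transcendental Literature.NumberTheory.Transcendental.KZ

/-! ### The padding block `E_1 = [0,1]^{k+1}` -/

section Pad
variable {n : ℕ}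

/-- The constant polynomial `1 ∈ ℚ[x₀, …, x_{k−1}]`. -/
def soloInformedPadPoly (k : ℕ) : MvPolynomial (Fin k) ℚ := 1

/-- `1(x) = 1`. -/
@[simp] theorem soloInformed_aeval_padPoly {k : ℕ} (x : Fin k → ℝ) :
    (MvPolynomial.aeval x (soloInformedPadPoly k) : ℝ) = 1 := by
  simp [soloInformedPadPoly]

/-- `1 ≥ 1` on the cube. -/
theorem soloInformed_padPoly_ge_one (k : ℕ) :
    ∀ x ∈ KZ.cube k, (1 : ℝ) ≤ MvPolynomial.aeval x (soloInformedPadPoly k) := fun x _ => by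
  rw [soloInformed_aeval_padPoly]

/-- **`vol E_1 = vol [0,1]^{k+1} = 1`.** -/
theorem soloInformed_value_padSolid (k : ℕ) :
    (soloInformedSubgraphRep (soloInformedPadPoly k) (soloInformed_padPoly_ge_one k)).value = 1 := by
  rw [soloInformed_value_subgraphRep]
  have e : ∀ x : Fin k → ℝ, ((MvPolynomial.aeval x (soloInformedPadPoly k) : ℝ))⁻¹ = (1 : ℝ) :=
    fun x => by rw [soloInformed_aeval_padPoly, inv_one]
  simp_rw [e]
  simp

/-- **Padding**: `q ∈ ℚ[x₀,…,x_{n−1}]` regarded in `n + k` variables, `q ⊠ 1`. -/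
def soloInformedPadMul (q : MvPolynomial (Fin n) ℚ) (k : ℕ) : MvPolynomial (Fin (n + k)) ℚ :=
  soloInformedBlockMul q (soloInformedPadPoly k)

/-- `q ≥ 1` on `[0,1]ⁿ ⇒ q ⊠ 1 ≥ 1` on `[0,1]^{n+k}`. -/
theorem soloInformed_padMul_ge_one (q : MvPolynomial (Fin n) ℚ)
    (hq : ∀ x ∈ KZ.cube n, (1 : ℝ) ≤ MvPolynomial.aeval x q) (k : ℕ) :
    ∀ x ∈ KZ.cube (n + k), (1 : ℝ) ≤ MvPolynomial.aeval x (soloInformedPadMul q k) :=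
  soloInformed_blockMul_ge_one _ _ hq (soloInformed_padPoly_ge_one k)

/-- **Padding preserves the volume: `vol E_{q ⊠ 1} = vol E_q`.** -/
theorem soloInformed_value_padRep (q : MvPolynomial (Fin n) ℚ)
    (hq : ∀ x ∈ KZ.cube n, (1 : ℝ) ≤ MvPolynomial.aeval x q) (k : ℕ) :
    (soloInformedSubgraphRep (soloInformedPadMul q k) (soloInformed_padMul_ge_one q hq k)).value =
      (soloInformedSubgraphRep q hq).value :=
  (soloInformed_value_blockRep q (soloInformedPadPoly k) hq (soloInformed_padPoly_ge_one k)).trans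
    (by rw [soloInformed_value_padSolid, mul_one])

/-- **Padding in `P`: `⟦E_{q ⊠ 1}⟧ = ⟦E_q⟧ · ⟦[0,1]^{k+1}⟧`** (Lemma K of the paper). -/
theorem soloInformed_toFormalPeriod_padRep (q : MvPolynomial (Fin n) ℚ)
    (hq : ∀ x ∈ KZ.cube n, (1 : ℝ) ≤ MvPolynomial.aeval x q) (k : ℕ) :
    toFormalPeriod (of (soloInformedSubgraphRep (soloInformedPadMul q k) (soloInformed_padMul_ge_one q hq k)))
      = toFormalPeriod (of (soloInformedSubgraphRep q hq)) *
        toFormalPeriod (of (soloInformedSubgraphRep (soloInformedPadPoly k) (soloInformed_padPoly_ge_one k))) :=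
  (soloInformed_toFormalPeriod_blockRep q (soloInformedPadPoly k) hq (soloInformed_padPoly_ge_one k)
    (soloInformed_padMul_ge_one q hq k)).symm

end Pad

/-! ### Face P1 (`LocRung₆`): `E_η(5)` against `E_η(3)` padded — `ζ(5)/ζ(3)` -/

/-- **`E_η(3)` padded to `[0,1]⁶`**: `{t (1 + x₀x₁x₂) ≤ 1} ⊂ [0,1]⁶`, volume `(3/4) ζ(3)`. -/
def soloInformedEtaThreePadSolid : IntegralRep 6 :=
  soloInformedSubgraphRep (soloInformedPadMul (soloInformedEtaPoly 3) 2)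
    (soloInformed_padMul_ge_one _ (soloInformed_etaPoly_ge_one 3) 2)

/-- `vol = (3/4) ζ(3)`. -/
theorem soloInformed_value_etaThreePadSolid :
    (soloInformedSubgraphRep (soloInformedPadMul (soloInformedEtaPoly 3) 2)
        (soloInformed_padMul_ge_one _ (soloInformed_etaPoly_ge_one 3) 2)).value =
      ((3 / 4 : ℚ) : ℝ) * zetaValue 3 :=
  (soloInformed_value_padRep _ (soloInformed_etaPoly_ge_one 3) 2).trans soloInformed_value_etaSolid_three

/-- **`ζ(5)/ζ(3) ∉ ℚ`** — OPEN (nothing is known about `ζ(5)/ζ(3)`) [Waldschmidt 2004, §3]. -/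
@[conjecture] def SoloInformedZetaFiveOverZetaThreeIrrational : Prop :=
  Irrational (zetaValue 5 / zetaValue 3)

/-- **`NoLocRel(η₅, η₃ ⊠ 1)`**: no `N`, no positive `a, b` with `⟦[π]⟧ᴺ · ⟦a·[E_η(5)] − b·[E_η(3) ⊠ [0,1]²]⟧ = 0`
(solids in `[0,1]⁶`; proved in the paper, Prop. L′; OPEN in the kernel). -/
@[conjecture] def SoloInformedEtaFiveEtaThreePadNoLocRelation : Prop :=
  ∀ N a b : ℕ, a ≠ 0 → b ≠ 0 →
    toFormalPeriod (of piRep) ^ N *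
      toFormalPeriod (a • of (soloInformedEtaSolid 5) - b • of soloInformedEtaThreePadSolid) ≠ 0

/-- `vol E_η(5) / vol (E_η(3) ⊠ 1) ∉ ℚ ↔ ζ(5)/ζ(3) ∉ ℚ` (the factor `5/4 ∈ ℚˣ`). -/
theorem soloInformed_faceP1_ratio_iff :
    Irrational ((soloInformedSubgraphRep (soloInformedEtaPoly 5) (soloInformed_etaPoly_ge_one 5)).value /
        (soloInformedSubgraphRep (soloInformedPadMul (soloInformedEtaPoly 3) 2)
          (soloInformed_padMul_ge_one _ (soloInformed_etaPoly_ge_one 3) 2)).value) ↔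
      SoloInformedZetaFiveOverZetaThreeIrrational := by
  rw [soloInformed_value_etaSolid_five, soloInformed_value_etaThreePadSolid]
  have hζ : zetaValue 3 ≠ 0 := (soloInformed_zetaValue_pos (n := 3) (by norm_num)).ne'
  refine soloInformed_irrational_congr_ratMul (5 / 4 : ℚ) (by norm_num) ?_
  push_cast
  field_simp
  ring

/-- **Face P1: `LocRung₆ → (NoLocRel(η₅, η₃ ⊠ 1) ↔ ζ(5)/ζ(3) ∉ ℚ)`.** -/
theorem soloInformed_locRung_six_faceP1_iff (h : SoloInformedLocVolumeRung 6) :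
    SoloInformedEtaFiveEtaThreePadNoLocRelation ↔ SoloInformedZetaFiveOverZetaThreeIrrational :=
  (soloInformed_locRung_subgraphNoLocRelation_iff (soloInformedEtaPoly 5)
    (soloInformedPadMul (soloInformedEtaPoly 3) 2) (soloInformed_etaPoly_ge_one 5)
    (soloInformed_padMul_ge_one _ (soloInformed_etaPoly_ge_one 3) 2) h).trans soloInformed_faceP1_ratio_iff

/-- `ζ(5)/ζ(3) ∉ ℚ → NoLocRel(η₅, η₃ ⊠ 1)`, unconditionally. -/
theorem soloInformed_faceP1_of_irrational (hirr : SoloInformedZetaFiveOverZetaThreeIrrational) :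
    SoloInformedEtaFiveEtaThreePadNoLocRelation := fun N a b ha _ =>
  soloInformed_subgraphNoLocRelation_of_irrational _ _ _ _ (soloInformed_faceP1_ratio_iff.2 hirr) N a b ha

/-! ### Faces P2–P6: `E_η(3)` against `E_G`, `Λ₁`, `A₁` padded; `E_G` against `A₁`, `Λ₁` padded -/

/-- **`E_G` padded to `[0,1]⁴`**: `{t (1 + x₀²x₁²) ≤ 1} ⊂ [0,1]⁴`, volume `G`. -/
def soloInformedCatalanPadSolid : IntegralRep 4 :=
  soloInformedSubgraphRep (soloInformedPadMul soloInformedCatalanPoly 1)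
    (soloInformed_padMul_ge_one _ soloInformed_catalanPoly_ge_one 1)

/-- `vol = G`. -/
theorem soloInformed_value_catalanPadSolid :
    (soloInformedSubgraphRep (soloInformedPadMul soloInformedCatalanPoly 1)
        (soloInformed_padMul_ge_one _ soloInformed_catalanPoly_ge_one 1)).value = catalanConstant :=
  (soloInformed_value_padRep _ soloInformed_catalanPoly_ge_one 1).trans soloInformed_value_catalanSolid

/-- **`ζ(3)/G ∉ ℚ`** — OPEN [Finch 2003, §§1.6, 1.7]. -/
@[conjecture] def SoloInformedZetaThreeOverCatalanIrrational : Prop :=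
  Irrational (zetaValue 3 / catalanConstant)

/-- **`NoLocRel(η₃, G ⊠ 1)`** (solids in `[0,1]⁴`; proved in the paper, Prop. L′; OPEN in the kernel). -/
@[conjecture] def SoloInformedEtaThreeCatalanPadNoLocRelation : Prop :=
  ∀ N a b : ℕ, a ≠ 0 → b ≠ 0 →
    toFormalPeriod (of piRep) ^ N *
      toFormalPeriod (a • of (soloInformedEtaSolid 3) - b • of soloInformedCatalanPadSolid) ≠ 0

/-- `vol E_η(3) / vol (E_G ⊠ 1) ∉ ℚ ↔ ζ(3)/G ∉ ℚ` (the factor `3/4`). -/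
theorem soloInformed_faceP2_ratio_iff :
    Irrational ((soloInformedSubgraphRep (soloInformedEtaPoly 3) (soloInformed_etaPoly_ge_one 3)).value /
        (soloInformedSubgraphRep (soloInformedPadMul soloInformedCatalanPoly 1)
          (soloInformed_padMul_ge_one _ soloInformed_catalanPoly_ge_one 1)).value) ↔
      SoloInformedZetaThreeOverCatalanIrrational := by
  rw [soloInformed_value_etaSolid_three, soloInformed_value_catalanPadSolid]
  exact soloInformed_irrational_congr_ratMul (3 / 4 : ℚ) (by norm_num) (mul_div_assoc _ _ _)

/-- **Face P2: `LocRung₄ → (NoLocRel(η₃, G ⊠ 1) ↔ ζ(3)/G ∉ ℚ)`.** -/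
theorem soloInformed_locRung_four_faceP2_iff (h : SoloInformedLocVolumeRung 4) :
    SoloInformedEtaThreeCatalanPadNoLocRelation ↔ SoloInformedZetaThreeOverCatalanIrrational :=
  (soloInformed_locRung_subgraphNoLocRelation_iff (soloInformedEtaPoly 3)
    (soloInformedPadMul soloInformedCatalanPoly 1) (soloInformed_etaPoly_ge_one 3)
    (soloInformed_padMul_ge_one _ soloInformed_catalanPoly_ge_one 1) h).trans soloInformed_faceP2_ratio_iff

/-- `ζ(3)/G ∉ ℚ → NoLocRel(η₃, G ⊠ 1)`, unconditionally. -/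
theorem soloInformed_faceP2_of_irrational (hirr : SoloInformedZetaThreeOverCatalanIrrational) :
    SoloInformedEtaThreeCatalanPadNoLocRelation := fun N a b ha _ =>
  soloInformed_subgraphNoLocRelation_of_irrational _ _ _ _ (soloInformed_faceP2_ratio_iff.2 hirr) N a b ha

/-- **`Λ₁` padded to `[0,1]⁴`**: `{t (1 + x₀) ≤ 1} ⊂ [0,1]⁴`, volume `log 2`. -/
def soloInformedLogPadThreeSolid : IntegralRep 4 :=
  soloInformedSubgraphRep (soloInformedPadMul (soloInformedLogPoly 1) 2)
    (soloInformed_padMul_ge_one _ (soloInformed_logPoly_ge_one 1) 2)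

/-- `vol = log 2`. -/
theorem soloInformed_value_logPadThreeSolid :
    (soloInformedSubgraphRep (soloInformedPadMul (soloInformedLogPoly 1) 2)
        (soloInformed_padMul_ge_one _ (soloInformed_logPoly_ge_one 1) 2)).value = Real.log 2 := by
  rw [soloInformed_value_padRep _ (soloInformed_logPoly_ge_one 1) 2,
    show (soloInformedSubgraphRep (soloInformedLogPoly 1) (soloInformed_logPoly_ge_one 1)).value =
      Real.log 2 ^ 1 from soloInformed_value_logSolid 1, pow_one]

/-- **`ζ(3)/log 2 ∉ ℚ`** — OPEN [Waldschmidt 2004, §3]. -/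
@[conjecture] def SoloInformedZetaThreeOverLogTwoIrrational : Prop :=
  Irrational (zetaValue 3 / Real.log 2)

/-- **`NoLocRel(η₃, Λ₁ ⊠ 1)`** (solids in `[0,1]⁴`; proved in the paper, Prop. L′; OPEN in the kernel). -/
@[conjecture] def SoloInformedEtaThreeLogPadNoLocRelation : Prop :=
  ∀ N a b : ℕ, a ≠ 0 → b ≠ 0 →
    toFormalPeriod (of piRep) ^ N *
      toFormalPeriod (a • of (soloInformedEtaSolid 3) - b • of soloInformedLogPadThreeSolid) ≠ 0

/-- `vol E_η(3) / vol (Λ₁ ⊠ 1) ∉ ℚ ↔ ζ(3)/log 2 ∉ ℚ` (the factor `3/4`). -/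
theorem soloInformed_faceP3_ratio_iff :
    Irrational ((soloInformedSubgraphRep (soloInformedEtaPoly 3) (soloInformed_etaPoly_ge_one 3)).value /
        (soloInformedSubgraphRep (soloInformedPadMul (soloInformedLogPoly 1) 2)
          (soloInformed_padMul_ge_one _ (soloInformed_logPoly_ge_one 1) 2)).value) ↔
      SoloInformedZetaThreeOverLogTwoIrrational := by
  rw [soloInformed_value_etaSolid_three, soloInformed_value_logPadThreeSolid]
  exact soloInformed_irrational_congr_ratMul (3 / 4 : ℚ) (by norm_num) (mul_div_assoc _ _ _)

/-- **Face P3: `LocRung₄ → (NoLocRel(η₃, Λ₁ ⊠ 1) ↔ ζ(3)/log 2 ∉ ℚ)`.** -/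
theorem soloInformed_locRung_four_faceP3_iff (h : SoloInformedLocVolumeRung 4) :
    SoloInformedEtaThreeLogPadNoLocRelation ↔ SoloInformedZetaThreeOverLogTwoIrrational :=
  (soloInformed_locRung_subgraphNoLocRelation_iff (soloInformedEtaPoly 3)
    (soloInformedPadMul (soloInformedLogPoly 1) 2) (soloInformed_etaPoly_ge_one 3)
    (soloInformed_padMul_ge_one _ (soloInformed_logPoly_ge_one 1) 2) h).trans soloInformed_faceP3_ratio_iff

/-- `ζ(3)/log 2 ∉ ℚ → NoLocRel(η₃, Λ₁ ⊠ 1)`, unconditionally. -/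
theorem soloInformed_faceP3_of_irrational (hirr : SoloInformedZetaThreeOverLogTwoIrrational) :
    SoloInformedEtaThreeLogPadNoLocRelation := fun N a b ha _ =>
  soloInformed_subgraphNoLocRelation_of_irrational _ _ _ _ (soloInformed_faceP3_ratio_iff.2 hirr) N a b ha

/-- **`A₁` padded to `[0,1]⁴`**: `{t (1 + x₀²) ≤ 1} ⊂ [0,1]⁴`, volume `π/4`. -/
def soloInformedAtanPadThreeSolid : IntegralRep 4 :=
  soloInformedSubgraphRep (soloInformedPadMul (soloInformedAtanPoly 1) 2)
    (soloInformed_padMul_ge_one _ (soloInformed_atanPoly_ge_one 1) 2)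

/-- `vol = π/4`. -/
theorem soloInformed_value_atanPadThreeSolid :
    (soloInformedSubgraphRep (soloInformedPadMul (soloInformedAtanPoly 1) 2)
        (soloInformed_padMul_ge_one _ (soloInformed_atanPoly_ge_one 1) 2)).value = Real.pi / 4 := by
  rw [soloInformed_value_padRep _ (soloInformed_atanPoly_ge_one 1) 2,
    show (soloInformedSubgraphRep (soloInformedAtanPoly 1) (soloInformed_atanPoly_ge_one 1)).value =
      (Real.pi / 4) ^ 1 from soloInformed_value_atanSolid 1, pow_one]

/-- **`ζ(3)/π ∉ ℚ`** — OPEN (Apéry gives `ζ(3) ∉ ℚ` only) [Finch 2003, §1.6]. -/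
@[conjecture] def SoloInformedZetaThreeOverPiIrrational : Prop :=
  Irrational (zetaValue 3 / Real.pi)

/-- **`NoLocRel(η₃, A₁ ⊠ 1)`** (solids in `[0,1]⁴`; proved in the paper, Prop. L′; OPEN in the kernel). -/
@[conjecture] def SoloInformedEtaThreeAtanPadNoLocRelation : Prop :=
  ∀ N a b : ℕ, a ≠ 0 → b ≠ 0 →
    toFormalPeriod (of piRep) ^ N *
      toFormalPeriod (a • of (soloInformedEtaSolid 3) - b • of soloInformedAtanPadThreeSolid) ≠ 0

/-- `vol E_η(3) / vol (A₁ ⊠ 1) ∉ ℚ ↔ ζ(3)/π ∉ ℚ` (the factor `3 ∈ ℚˣ`). -/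
theorem soloInformed_faceP4_ratio_iff :
    Irrational ((soloInformedSubgraphRep (soloInformedEtaPoly 3) (soloInformed_etaPoly_ge_one 3)).value /
        (soloInformedSubgraphRep (soloInformedPadMul (soloInformedAtanPoly 1) 2)
          (soloInformed_padMul_ge_one _ (soloInformed_atanPoly_ge_one 1) 2)).value) ↔
      SoloInformedZetaThreeOverPiIrrational := by
  rw [soloInformed_value_etaSolid_three, soloInformed_value_atanPadThreeSolid]
  refine soloInformed_irrational_congr_ratMul (3 : ℚ) (by norm_num) ?_
  push_cast
  ring

/-- **Face P4: `LocRung₄ → (NoLocRel(η₃, A₁ ⊠ 1) ↔ ζ(3)/π ∉ ℚ)`.** -/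
theorem soloInformed_locRung_four_faceP4_iff (h : SoloInformedLocVolumeRung 4) :
    SoloInformedEtaThreeAtanPadNoLocRelation ↔ SoloInformedZetaThreeOverPiIrrational :=
  (soloInformed_locRung_subgraphNoLocRelation_iff (soloInformedEtaPoly 3)
    (soloInformedPadMul (soloInformedAtanPoly 1) 2) (soloInformed_etaPoly_ge_one 3)
    (soloInformed_padMul_ge_one _ (soloInformed_atanPoly_ge_one 1) 2) h).trans soloInformed_faceP4_ratio_iff

/-- `ζ(3)/π ∉ ℚ → NoLocRel(η₃, A₁ ⊠ 1)`, unconditionally. -/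
theorem soloInformed_faceP4_of_irrational (hirr : SoloInformedZetaThreeOverPiIrrational) :
    SoloInformedEtaThreeAtanPadNoLocRelation := fun N a b ha _ =>
  soloInformed_subgraphNoLocRelation_of_irrational _ _ _ _ (soloInformed_faceP4_ratio_iff.2 hirr) N a b ha

/-- **`A₁` padded to `[0,1]³`**: `{t (1 + x₀²) ≤ 1} ⊂ [0,1]³`, volume `π/4`. -/
def soloInformedAtanPadTwoSolid : IntegralRep 3 :=
  soloInformedSubgraphRep (soloInformedPadMul (soloInformedAtanPoly 1) 1)
    (soloInformed_padMul_ge_one _ (soloInformed_atanPoly_ge_one 1) 1)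

/-- `vol = π/4`. -/
theorem soloInformed_value_atanPadTwoSolid :
    (soloInformedSubgraphRep (soloInformedPadMul (soloInformedAtanPoly 1) 1)
        (soloInformed_padMul_ge_one _ (soloInformed_atanPoly_ge_one 1) 1)).value = Real.pi / 4 := by
  rw [soloInformed_value_padRep _ (soloInformed_atanPoly_ge_one 1) 1,
    show (soloInformedSubgraphRep (soloInformedAtanPoly 1) (soloInformed_atanPoly_ge_one 1)).value =
      (Real.pi / 4) ^ 1 from soloInformed_value_atanSolid 1, pow_one]

/-- **`G/π ∉ ℚ`** — OPEN (even `G ∉ ℚ` is open) [Finch 2003, §1.7]. -/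
@[conjecture] def SoloInformedCatalanOverPiIrrational : Prop :=
  Irrational (catalanConstant / Real.pi)

/-- **`NoLocRel(G, A₁ ⊠ 1)`** (solids in `[0,1]³`; paper, Prop. L′: degrees `1 ≠ 0`; OPEN in the kernel). -/
@[conjecture] def SoloInformedCatalanAtanPadNoLocRelation : Prop :=
  ∀ N a b : ℕ, a ≠ 0 → b ≠ 0 →
    toFormalPeriod (of piRep) ^ N *
      toFormalPeriod (a • of soloInformedCatalanSolid - b • of soloInformedAtanPadTwoSolid) ≠ 0

/-- `vol E_G / vol (A₁ ⊠ 1) ∉ ℚ ↔ G/π ∉ ℚ` (the factor `4`). -/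
theorem soloInformed_faceP5_ratio_iff :
    Irrational ((soloInformedSubgraphRep soloInformedCatalanPoly soloInformed_catalanPoly_ge_one).value /
        (soloInformedSubgraphRep (soloInformedPadMul (soloInformedAtanPoly 1) 1)
          (soloInformed_padMul_ge_one _ (soloInformed_atanPoly_ge_one 1) 1)).value) ↔
      SoloInformedCatalanOverPiIrrational := by
  rw [show (soloInformedSubgraphRep soloInformedCatalanPoly soloInformed_catalanPoly_ge_one).value =
      catalanConstant from soloInformed_value_catalanSolid, soloInformed_value_atanPadTwoSolid]
  refine soloInformed_irrational_congr_ratMul (4 : ℚ) (by norm_num) ?_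
  push_cast
  ring

/-- **Face P5: `LocRung₃ → (NoLocRel(G, A₁ ⊠ 1) ↔ G/π ∉ ℚ)`.** -/
theorem soloInformed_locRung_three_faceP5_iff (h : SoloInformedLocVolumeRung 3) :
    SoloInformedCatalanAtanPadNoLocRelation ↔ SoloInformedCatalanOverPiIrrational :=
  (soloInformed_locRung_subgraphNoLocRelation_iff soloInformedCatalanPoly
    (soloInformedPadMul (soloInformedAtanPoly 1) 1) soloInformed_catalanPoly_ge_one
    (soloInformed_padMul_ge_one _ (soloInformed_atanPoly_ge_one 1) 1) h).trans soloInformed_faceP5_ratio_iff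

/-- `G/π ∉ ℚ → NoLocRel(G, A₁ ⊠ 1)`, unconditionally. -/
theorem soloInformed_faceP5_of_irrational (hirr : SoloInformedCatalanOverPiIrrational) :
    SoloInformedCatalanAtanPadNoLocRelation := fun N a b ha _ =>
  soloInformed_subgraphNoLocRelation_of_irrational _ _ _ _ (soloInformed_faceP5_ratio_iff.2 hirr) N a b ha

/-- **`Λ₁` padded to `[0,1]³`**: `{t (1 + x₀) ≤ 1} ⊂ [0,1]³`, volume `log 2`. -/
def soloInformedLogPadTwoSolid : IntegralRep 3 :=
  soloInformedSubgraphRep (soloInformedPadMul (soloInformedLogPoly 1) 1)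
    (soloInformed_padMul_ge_one _ (soloInformed_logPoly_ge_one 1) 1)

/-- `vol = log 2`. -/
theorem soloInformed_value_logPadTwoSolid :
    (soloInformedSubgraphRep (soloInformedPadMul (soloInformedLogPoly 1) 1)
        (soloInformed_padMul_ge_one _ (soloInformed_logPoly_ge_one 1) 1)).value = Real.log 2 := by
  rw [soloInformed_value_padRep _ (soloInformed_logPoly_ge_one 1) 1,
    show (soloInformedSubgraphRep (soloInformedLogPoly 1) (soloInformed_logPoly_ge_one 1)).value =
      Real.log 2 ^ 1 from soloInformed_value_logSolid 1, pow_one]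

/-- **`G/log 2 ∉ ℚ`** — OPEN [Finch 2003, §1.7]. -/
@[conjecture] def SoloInformedCatalanOverLogTwoIrrational : Prop :=
  Irrational (catalanConstant / Real.log 2)

/-- **`NoLocRel(G, Λ₁ ⊠ 1)`** (solids in `[0,1]³`; paper, Prop. L′: equal degree, distinct weights). -/
@[conjecture] def SoloInformedCatalanLogPadNoLocRelation : Prop :=
  ∀ N a b : ℕ, a ≠ 0 → b ≠ 0 →
    toFormalPeriod (of piRep) ^ N *
      toFormalPeriod (a • of soloInformedCatalanSolid - b • of soloInformedLogPadTwoSolid) ≠ 0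

/-- `vol E_G / vol (Λ₁ ⊠ 1) ∉ ℚ ↔ G/log 2 ∉ ℚ`. -/
theorem soloInformed_faceP6_ratio_iff :
    Irrational ((soloInformedSubgraphRep soloInformedCatalanPoly soloInformed_catalanPoly_ge_one).value /
        (soloInformedSubgraphRep (soloInformedPadMul (soloInformedLogPoly 1) 1)
          (soloInformed_padMul_ge_one _ (soloInformed_logPoly_ge_one 1) 1)).value) ↔
      SoloInformedCatalanOverLogTwoIrrational := by
  rw [show (soloInformedSubgraphRep soloInformedCatalanPoly soloInformed_catalanPoly_ge_one).value =
      catalanConstant from soloInformed_value_catalanSolid, soloInformed_value_logPadTwoSolid]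
  rfl

/-- **Face P6: `LocRung₃ → (NoLocRel(G, Λ₁ ⊠ 1) ↔ G/log 2 ∉ ℚ)`.** -/
theorem soloInformed_locRung_three_faceP6_iff (h : SoloInformedLocVolumeRung 3) :
    SoloInformedCatalanLogPadNoLocRelation ↔ SoloInformedCatalanOverLogTwoIrrational :=
  (soloInformed_locRung_subgraphNoLocRelation_iff soloInformedCatalanPoly
    (soloInformedPadMul (soloInformedLogPoly 1) 1) soloInformed_catalanPoly_ge_one
    (soloInformed_padMul_ge_one _ (soloInformed_logPoly_ge_one 1) 1) h).trans soloInformed_faceP6_ratio_iff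

/-- `G/log 2 ∉ ℚ → NoLocRel(G, Λ₁ ⊠ 1)`, unconditionally. -/
theorem soloInformed_faceP6_of_irrational (hirr : SoloInformedCatalanOverLogTwoIrrational) :
    SoloInformedCatalanLogPadNoLocRelation := fun N a b ha _ =>
  soloInformed_subgraphNoLocRelation_of_irrational _ _ _ _ (soloInformed_faceP6_ratio_iff.2 hirr) N a b ha

/-- **Six padded monomial faces of the Kontsevich–Zagier conjecture.**  Under
`KontsevichZagierPeriods` the no-certificate statements P1–P6 are EXACTLY the open irrationality
statements `ζ(5)/ζ(3)`, `ζ(3)/G`, `ζ(3)/log 2`, `ζ(3)/π`, `G/π`, `G/log 2 ∉ ℚ`. -/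
theorem soloInformed_kz_lengthFacesPadded (hKZ : KontsevichZagierPeriods) :
    (SoloInformedEtaFiveEtaThreePadNoLocRelation ↔ SoloInformedZetaFiveOverZetaThreeIrrational) ∧
    (SoloInformedEtaThreeCatalanPadNoLocRelation ↔ SoloInformedZetaThreeOverCatalanIrrational) ∧
    (SoloInformedEtaThreeLogPadNoLocRelation ↔ SoloInformedZetaThreeOverLogTwoIrrational) ∧
    (SoloInformedEtaThreeAtanPadNoLocRelation ↔ SoloInformedZetaThreeOverPiIrrational) ∧
    (SoloInformedCatalanAtanPadNoLocRelation ↔ SoloInformedCatalanOverPiIrrational) ∧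
    (SoloInformedCatalanLogPadNoLocRelation ↔ SoloInformedCatalanOverLogTwoIrrational) :=
  ⟨soloInformed_locRung_six_faceP1_iff (soloInformed_locVolumeRung_of_kzp hKZ 6),
    soloInformed_locRung_four_faceP2_iff (soloInformed_locVolumeRung_of_kzp hKZ 4),
    soloInformed_locRung_four_faceP3_iff (soloInformed_locVolumeRung_of_kzp hKZ 4),
    soloInformed_locRung_four_faceP4_iff (soloInformed_locVolumeRung_of_kzp hKZ 4),
    soloInformed_locRung_three_faceP5_iff (soloInformed_locVolumeRung_of_kzp hKZ 3),
    soloInformed_locRung_three_faceP6_iff (soloInformed_locVolumeRung_of_kzp hKZ 3)⟩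

end Summit.KontsevichZagierPeriods.KontsevichZagierPeriods.Theorems

end
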